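import Summits.KontsevichZagierPeriods.KontsevichZagierPeriods.Theorems.SymplecticScissorsRealOnePeriodRelationsRatLayer
import Summits.KontsevichZagierPeriods.KontsevichZagierPeriods.Theorems.SymplecticScissorsRealOnePeriodRelationsIsoLayer
import Summits.KontsevichZagierPeriods.KontsevichZagierPeriods.Theorems.SymplecticScissorsRealOnePeriodRelationsStubAlgRatCells

/-!
# `RealOnePeriodRelations` (stmt-KontsevichZagierPeriods-10042), line `nash-retraction-thin-strip`, reshape 9a:
# the GENUS-0 layer of the crux IN ALGEBRAIC CLOTHES, unconditionally

The rational layer of c1 (`RationalLayer.realOnePeriodRelations_ratLayer`) takes Kontsevich–Zagier's LITERAL rational representations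
(integrands with rational coefficients); its cells and arcs (`RationalLayer.stub_ratCells`, `RationalLayer.ratArcs`) already live over the
real algebraic numbers.  This file widens the entry predicate to rational integrands `P/Q` with real ALGEBRAIC coefficients on intervals
with real algebraic end points (`Q ≠ 0` on the open interval): logarithms of real algebraic numbers `∫_1^θ dx/x`, `π`, values of rational
primitives at algebraic points.

* `realOnePeriodRelations_algRatLayer` — every `ℤ`-relation with value `0` among such representations lies in
  `M₁ = closure (1a ∪ 1b ∪ 2 ∪ Green)`: the sector-parametric composition `SectorGlue.realOnePeriodRelations_of_sector` with the cells of
  `ConicLayer.stub_algRatCells` (affine rule-2 normalisation onto `(0,1)`), the arcs `RationalLayer.ratArcs` and the genus-0 case of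
  Huber–Wüstholz's theorem proved from Baker's theorem (`CurvePeriods.huberWustholzCurvePeriods_of_puncturedLine`).

References: A. Huber, G. Wüstholz, *Transcendence and Linear Relations of 1-Periods* (CUP 2022), Thm 13.3 (2), Rem. 15.11; A. Baker,
*Transcendental Number Theory* (CUP 1975), Thm 2.1; M. Kontsevich, D. Zagier, *Periods* (2001), §1.1–§1.2.
-/

noncomputable section

open scoped BigOperators Polynomial
open Set MeasureTheory MvPolynomial
open Literature.NumberTheory.Transcendental Literature.NumberTheory.Transcendental.CurvePeriods
open Summit.KontsevichZagierPeriods.SymplecticScissors.RealOnePeriodRelationsNegative (M₁ H₁)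

namespace Summit.KontsevichZagierPeriods.SymplecticScissors.RealOnePeriodRelations

namespace ConicLayer

/-- **THE GENUS-0 LAYER IN ALGEBRAIC CLOTHES, UNCONDITIONALLY.**  Every `ℤ`-combination with vanishing value of Kontsevich–Zagier's
literal rational representations and of representations `∫_a^b P/Q` with real ALGEBRAIC coefficients and end points (`Q ≠ 0` on
`(a, b)`; e.g. `log` of a real algebraic number `∫_1^θ dx/x`, `π = ∫ …`) lies in `M₁ = closure (1a ∪ 1b ∪ 2 ∪ Green)`.  Proof: the
sector-parametric composition `SectorGlue.realOnePeriodRelations_of_sector` with the cells of `stub_algRatCells`, the landed arcs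
`RationalLayer.ratArcs` (every unit algebraic-rational cell is the real realisation of a symbol on a punctured line `Z_a`) and the
genus-0 case of Huber–Wüstholz's theorem, PROVED in the tree from Baker's theorem (`CurvePeriods.huberWustholzCurvePeriods_of_puncturedLine`).
[cite: HuberWustholz2022, Thm 13.3 (2), Rem. 15.11] [cite: Baker1975, Thm 2.1] [cite: KontsevichZagier2001, §1.2] -/
theorem realOnePeriodRelations_algRatLayer : ∀ c : KZ.FormalRep,
    c ∈ AddSubgroup.closure ((fun r : KZ.IntegralRep 1 => KZ.of r) ''
      {r | r.IsRational ∨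
        (∃ a b : ℝ, IsAlgebraic ℚ a ∧ IsAlgebraic ℚ b ∧ a < b ∧ r.domain = {z | z 0 ∈ Set.Ioo a b} ∧
          ∃ P Q : Polynomial (algebraicClosure ℚ ℝ), (∀ x ∈ Set.Ioo a b, Polynomial.aeval x Q ≠ 0) ∧
            ∀ x ∈ Set.Ioo a b, r.integrand (fun _ => x) = Polynomial.aeval x P / Polynomial.aeval x Q)}) →
    KZ.eval c = 0 →
    c ∈ AddSubgroup.closure (KZ.domainAddRel ∪ KZ.integrandAddRel ∪ KZ.changeOfVariablesRel ∪
      {g : KZ.FormalRep | ∃ (Δ : Set (Fin 2 → ℝ)) (A B S : (Fin 2 → ℝ) → ℝ) (r₀₁ r₁₂ r₀₂ : KZ.IntegralRep 1),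
        Δ = {p | 0 ≤ p 0 ∧ 0 ≤ p 1 ∧ p 0 + p 1 ≤ 1} ∧ IsSemialgebraicFunOn ℚ Δ A ∧ IsSemialgebraicFunOn ℚ Δ B ∧
        ContinuousOn A Δ ∧ ContinuousOn B Δ ∧
        (∀ p : Fin 2 → ℝ, 0 < p 0 → 0 < p 1 → p 0 + p 1 < 1 →
          HasFDerivAt S (A p • ContinuousLinearMap.proj (R := ℝ) (φ := fun _ : Fin 2 => ℝ) 0 +
            B p • ContinuousLinearMap.proj (R := ℝ) (φ := fun _ : Fin 2 => ℝ) 1) p) ∧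
        r₀₁.domain = {z | z 0 ∈ Set.Ioo 0 1} ∧ r₁₂.domain = {z | z 0 ∈ Set.Ioo 0 1} ∧
        r₀₂.domain = {z | z 0 ∈ Set.Ioo 0 1} ∧ (∀ z ∈ r₀₁.domain, r₀₁.integrand z = A ![z 0, 0]) ∧
        (∀ z ∈ r₁₂.domain, r₁₂.integrand z = B ![1 - z 0, z 0] - A ![1 - z 0, z 0]) ∧
        (∀ z ∈ r₀₂.domain, r₀₂.integrand z = B ![0, z 0]) ∧ g = KZ.of r₀₁ + KZ.of r₁₂ - KZ.of r₀₂}) := by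
  intro c hc heval
  change c ∈ M₁
  refine SectorGlue.realOnePeriodRelations_of_sector _ _
    (fun s => (∃ (r : ℕ) (a : Fin r → ℂ), Function.Injective a ∧ (∀ i, IsAlgebraic ℚ (a i)) ∧
        s.Z = (⟨2, 1, ![X 1 * ∏ i, (X 0 - MvPolynomial.C (a i)) - 1]⟩ : CurveData)))
    (fun C hCalg hCsupp hC0 => huberWustholzCurvePeriods_of_puncturedLine C hCalg (fun s hs => Or.inl (hCsupp s hs)) hC0)
    stub_algRatCells RationalLayer.ratArcs c hc heval


end ConicLayer

end Summit.KontsevichZagierPeriods.SymplecticScissors.RealOnePeriodRelations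

end
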